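import Literature.RepresentationTheory.FiniteGroups.DoubleCosetOrbits
import Literature.GroupTheory.Index.DoubleCosetCardinality
import Mathlib.Data.Set.Card.Arithmetic
import HarnessLib

/-!
# The number of double cosets through the conjugates of `K`:
# `|H| · |H\G/K| = [N_G(K) : K] · Σ_{K' ∼ K} |K' ∩ H|` (Rojas 2007, Lemma 3.3)

Topic `Literature/GroupTheory/Index`, namespace `Literature.GroupTheory.Index`; everything proved (no definition, no
named fact, no instance).  Lane `lit-hodgefound` (Track 2 foundations library), seat p04, generation 41, row g41-#3:
the group-theoretic lemma behind Rojas' Proposition 3.2 (the genus of `S/H` from the geometric signature through the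
normalizers `N_G(G_j)`), complementing the tree's Burnside count of double cosets
(`Literature/RepresentationTheory/FiniteGroups/DoubleCosetOrbits`: `|H| · #(H\G/K) = Σ_{h ∈ H} |Fix_{G/K}(h)|`) and
the size of one double coset (`DoubleCosetCardinality`: `|HaK| · |H ∩ aKa⁻¹| = |H| · |K|`).

## Source, verbatim

A. M. Rojas, *Group actions on Jacobian varieties*, Rev. Mat. Iberoam. **23** (2007) 397–420, p. 403 (held
`paper:doi-10-4171-rmi-500`): «**Lemma 3.3.** Let `G` be a finite group having subgroups `H` and `K`, and let `H\G/K`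
be the corresponding set of double cosets. Then its cardinality is given by
`|H\G/K| = Σ_{l_j ∈ Ω_K} [N_G(K) : K] · |K^{l_j⁻¹} ∩ H| / |H|`, where `Ω_K` is a left transversal of `N_G(K)` in `G`.
*Proof.* Set `n = |H\G/K|` and consider the action of `H` on the left cosets `I_K` of `K` in `G` given by
multiplication on the left. Then the stabilizer of `g_i ∈ I_K` in `H` is `K^{g_i⁻¹} ∩ H` […] Hence `k = n`; that
is, `|I_K/H| = |H\G/K|`. On the other hand, consider the action of `G` on `I_K` given by multiplication on the left.
Then the stabilizer of `g_i ∈ I_K` in `G` is `K^{g_i⁻¹}`. […] we have the set `I_K` divided into `[G : N_G(K)]`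
packages, and each package has `[N_G(K) : K]` points associated to the same stabilizer. […] for each package of
points with the same stabilizer in `G` we will have `[N_G(K) : K] · |K^{g_i⁻¹} ∩ H| / |H|` points in `I_K/H`.»
(Rojas writes `H^l := {lgl⁻¹ : g ∈ H}`.)

## Dictionary and the form proved

As `l` runs over a transversal of `N_G(K)` the groups `lKl⁻¹` run once through the conjugacy class of `K`, so the
printed sum is the sum over the CONJUGATES `K'` of `K` (the set `{gKg⁻¹ : g ∈ G}`, here
`Set.range (g ↦ K.map (conj g))`), each counted once; multiplying through by `|H|·|K|` to stay in `ℕ`, Lemma 3.3 reads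
**`|K| · |H| · |H\G/K| = |N_G(K)| · Σ_{K' ∼ K} |H ∩ K'|`** (`natCard_mul_natCard_mul_natCard_doubleCoset_eq`).  The
proof is the printed double count: `|H| · |H\G/K| = Σ_{h ∈ H} |Fix_{G/K}(h)|` (Burnside, tree), `|K| · |Fix_{G/K}(h)| =
#{g ∈ G : g⁻¹hg ∈ K}` (the stabilizer of `gK` in `G` is `gKg⁻¹`), `Σ_h #{g : g⁻¹hg ∈ K} = Σ_{g ∈ G} |H ∩ gKg⁻¹|`, and
`g ↦ gKg⁻¹` has fibres the cosets of `N_G(K)` («packages»), so `Σ_{g ∈ G} φ(gKg⁻¹) = |N_G(K)| · Σ_{K' ∼ K} φ(K')`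
(`sum_map_conj_eq_card_normalizer_mul_finsum`) and `#{K' ∼ K} · |N_G(K)| = |G|` (`ncard_range_map_conj_mul_card_normalizer`).

## What is proved

`natCard_mul_natCard_fixedBy_quotient` (`|K|·|Fix_{G/K}(h)| = #{g : g⁻¹hg ∈ K}`), `card_filter_conj_mem_eq_card_inf_map_conj`
(`#{h ∈ H : g⁻¹hg ∈ K} = |H ∩ gKg⁻¹|`), **`sum_natCard_fixedBy_quotient_mul_eq_sum_natCard_inf`** (the double count),
`map_conj_eq_map_conj_iff` (`gKg⁻¹ = g'Kg'⁻¹ ⟺ g⁻¹g' ∈ N_G(K)`), `card_filter_map_conj_eq`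
(each fibre of `g ↦ gKg⁻¹` has `|N_G(K)|` elements), **`sum_map_conj_eq_card_normalizer_mul_finsum`**,
`ncard_range_map_conj_mul_card_normalizer` (`#conjugates · |N_G(K)| = |G|`), LEMMA 3.3
**`natCard_mul_natCard_mul_natCard_doubleCoset_eq`**, and its combination with `|H|·[G:H] = |G|` used for Prop. 3.2 ⟺
Cor. 3.4: **`index_sub_natCard_doubleCoset_eq_finsum`** (`[G:H] − |H\G/K| = Σ_{K' ∼ K} (|N_G(K)|/|H|)(1 − |K' ∩ H|/|K|)` over `ℚ`).
§2 (v2, ADD-ONLY): `map_conj_eq_self_of_normal`, `range_map_conj_eq_singleton_of_normal`,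
**`natCard_mul_natCard_mul_natCard_doubleCoset_of_normal`** (`L ⊴ G`: `|L|·|K|·|K\G/L| = |G|·|K ∩ L|`).
§3 (v3, ADD-ONLY) LEMMA 5.9: `card_filter_conj_eq_conj_eq_card_centralizer`, **`natCard_setOf_conj_mem_eq_card_centralizer_mul`**
(`#{g : g⁻¹ag ∈ K} = |C_G(a)|·|ā ∩ K|`), `card_centralizer_mul_ncard_conjugatesOf` (`|C_G(a)|·|ā| = |G|`),
`natCard_mul_natCard_fixedBy_quotient_eq_card_centralizer_mul` (`|K|·|Fix_{G/K}(a)| = |C_G(a)|·|ā ∩ K|`),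
**`natCard_mul_natCard_mul_natCard_doubleCoset_eq_sum_centralizer`** (`|K|·|H|·|H\G/K| = Σ_{a ∈ H} |C_G(a)|·|ā ∩ K|`) and
**`natCard_doubleCoset_eq_sum_div`** (Lemma 5.9 as printed, over `ℚ`).
§4 (v4, ADD-ONLY) PROPOSITION 3.5 (p. 404: «As the cover `π_H` is Galois, the description of any branch value is done by
marking it with a number: the order of the stabilizer of any point in its fiber. […] for each `j` choose any element
`l₁ ∈ Ω_{G_j}` and build the set `L_{j1} := {l ∈ Ω_{G_j} : |G_j^{l⁻¹} ∩ H| = |G_j^{l₁⁻¹} ∩ H|}` […] **Proposition 3.5.** Let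
`S` be a Riemann Surface with `G`-action and geometric signature `(γ; [m₁, C₁], …, [m_t, C_t])`. Then, there are
`c_k := |L_k| · [N_G(G_j) : G_j] · |G_j^{l_{k-1}⁻¹} ∩ H| / |H|` (`1 ≤ j ≤ t`, `1 ≤ k ≤ ν_j`) points on `S/H` marked with the
number `|G_j^{l_{k-1}⁻¹} ∩ H|` for the action of `H ≤ G`.»), in its group-theoretic content — the points of `S` over the
branch value `q_j` are the cosets `I_K`, `K = G_j`, their images in `S/H` the `H`-orbits = double cosets `HgK`, the mark of
`HgK` is `|H ∩ gKg⁻¹|`: `map_conj_mul_eq_of_mem`, `map_conj_mul_eq_map_map`, `map_conj_eq_self_of_mem`,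
`inf_map_conj_eq_map_inf_of_mem`, **`natCard_inf_map_conj_eq_of_mk_eq`** (the mark is well defined on `HgK`),
`natCard_inf_map_conj_out_mk`, **`mul_natCard_setOf_natCard_inf_map_conj_eq`** (`n·#{g : mark n} = |H|·|K|·#{HgK : mark n}`),
**`natCard_setOf_natCard_inf_map_conj_eq`** (`#{g : mark n} = |N_G(K)|·#{K' ∼ K : |H ∩ K'| = n}`), PROPOSITION 3.5
**`natCard_mul_natCard_mul_natCard_doubleCoset_mark_eq`** (`|K|·|H|·#{HgK : mark n} = n·|N_G(K)|·#{K' ∼ K : |H ∩ K'| = n}`)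
and the printed division form **`natCard_doubleCoset_mark_eq_div`** (`c = |L|·[N_G(K) : K]·n/|H|`).
§5 (v5, ADD-ONLY) CURRENCY BRIDGES to the permutation-character files of `Literature/RepresentationTheory/FiniteGroups`
(`PermutationCharacter`: `indClassFun_one_eq_natCard_fixedBy_quotient`, `1_K^G = (g ↦ |Fix_{G/K}(g)|)`;
`TransitivePermutationCharacter`: Isaacs Thm. 5.18 (g) `|Cl(g)|·|fix_{G/H}(g)| = |Cl(g) ∩ H|·|G : H|` with `Cl(g)` the
SUBTYPE `{x // IsConj g x}`): `ncard_conjugatesOf_eq_natCard_subtype_isConj` (`|ā|` set vs subtype),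
`ncard_conjugatesOf_inter_eq_natCard_subtype_isConj` (`|ā ∩ K|`), **`natCard_mul_indClassFun_one_apply`**
(`|K| · 1_K^G(a) = |C_G(a)| · |ā ∩ K|`), `indClassFun_one_apply_eq_card_centralizer_mul_div` and
**`indClassFun_one_apply_eq_index_mul_div`** (`1_K^G(a) = [G : K]·|ā ∩ K|/|ā|`, the number of cosets fixed by `a` as
Rojas prints it in the proof of Lemma 5.9); these need `G : Type` (the universe of `indClassFun`).

## References

* [Rojas2007] A. M. Rojas, *Group actions on Jacobian varieties*, Rev. Mat. Iberoam. 23 (2007), Lemma 3.3 with proof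
  (p. 403), Lemma 3.1 (the packages), Proposition 3.5 (p. 404), Lemma 5.9 with proof (p. 413).
* [Isaacs1976] I. M. Isaacs, *Character Theory of Finite Groups*, Academic Press (1976), Lemma 5.14, Thm. 5.18 (g) with
  proof (pp. 68–69).
* [CeccherinisilbersteScarabottiTolli2018] T. Ceccherini-Silberstein, F. Scarabotti, F. Tolli, *Discrete Harmonic
  Analysis*, CUP (2018), §10.4 (Burnside's lemma; double cosets as orbits).
-/

open MulAction
open scoped Pointwise

namespace Literature.GroupTheory.Index

section Lemma33

variable {G : Type*} [Group G] (H K : Subgroup G)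

/-- **`|K| · |Fix_{G/K}(h)| = #{g ∈ G : g⁻¹ h g ∈ K}`**: the coset `gK` is fixed by `h` iff `g⁻¹hg ∈ K` («the stabilizer
of `g_i ∈ I_K` in `G` is `K^{g_i⁻¹}`»), and each coset has `|K|` representatives. [cite: Rojas2007, Lemma 3.3 (proof)] -/
theorem natCard_mul_natCard_fixedBy_quotient (h : G) :
    Nat.card K * Nat.card (fixedBy (G ⧸ K) h) = Nat.card {g : G | g⁻¹ * h * g ∈ K} := by
  have hset : (QuotientGroup.mk ⁻¹' fixedBy (G ⧸ K) h : Set G) = {g : G | g⁻¹ * h * g ∈ K} := by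
    ext g
    rw [Set.mem_preimage, MulAction.mem_fixedBy, Set.mem_setOf_eq]
    change ((h * g : G) : G ⧸ K) = (g : G ⧸ K) ↔ _
    rw [eq_comm, QuotientGroup.eq, mul_assoc]
  rw [← hset, QuotientGroup.card_preimage_mk]

open Classical in
/-- **`#{h ∈ H : g⁻¹ h g ∈ K} = |H ∩ gKg⁻¹|`** («the stabilizer of `g_i ∈ I_K` in `H` is `K^{g_i⁻¹} ∩ H`»).
[cite: Rojas2007, Lemma 3.3 (proof)] -/
theorem card_filter_conj_mem_eq_card_inf_map_conj [Fintype G] (g : G) :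
    (Finset.univ.filter fun h : G ↦ h ∈ H ∧ g⁻¹ * h * g ∈ K).card =
      Nat.card ↥(H ⊓ K.map (MulAut.conj g).toMonoidHom) := by
  rw [Nat.card_eq_fintype_card, ← Fintype.card_coe]
  refine Fintype.card_congr (Equiv.subtypeEquiv (Equiv.refl G) fun h ↦ ?_)
  rw [Finset.mem_filter, Equiv.refl_apply, Subgroup.mem_inf, mem_map_conj_iff]
  simp only [Finset.mem_univ, true_and]

open Classical in
/-- **The double count `Σ_{h ∈ H} |K|·|Fix_{G/K}(h)| = Σ_{g ∈ G} |H ∩ gKg⁻¹|`** (both count the pairs `(h, g) ∈ H × G`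
with `g⁻¹hg ∈ K`). [cite: Rojas2007, Lemma 3.3 (proof)] -/
theorem sum_natCard_fixedBy_quotient_mul_eq_sum_natCard_inf [Fintype G] :
    ∑ h : ↥H, Nat.card K * Nat.card (fixedBy (G ⧸ K) h) =
      ∑ g : G, Nat.card ↥(H ⊓ K.map (MulAut.conj g).toMonoidHom) := by
  -- (`↥H` acting on `G ⧸ K` through `G`) both sides equal `Σ_{h ∈ H} Σ_{g ∈ G} [g⁻¹hg ∈ K]`
  have hL : ∀ h : G, Nat.card {g : G | g⁻¹ * h * g ∈ K} =
      ∑ g : G, if g⁻¹ * h * g ∈ K then 1 else 0 := fun h ↦ by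
    rw [Nat.card_eq_fintype_card, ← Set.toFinset_card, Finset.card_eq_sum_ones, Finset.sum_ite, Finset.sum_const_zero,
      add_zero]
    congr 1
    ext g
    simp only [Set.mem_toFinset, Set.mem_setOf_eq, Finset.mem_filter, Finset.mem_univ, true_and]
  have hR : ∀ g : G, Nat.card ↥(H ⊓ K.map (MulAut.conj g).toMonoidHom) =
      ∑ h : G, if h ∈ H ∧ g⁻¹ * h * g ∈ K then 1 else 0 := fun g ↦ by
    rw [← card_filter_conj_mem_eq_card_inf_map_conj H K g, Finset.card_eq_sum_ones, Finset.sum_ite,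
      Finset.sum_const_zero, add_zero]
  calc ∑ h : ↥H, Nat.card K * Nat.card (fixedBy (G ⧸ K) h)
      = ∑ h : ↥H, ∑ g : G, (if g⁻¹ * (h : G) * g ∈ K then 1 else 0) :=
        Finset.sum_congr rfl fun h _ ↦ by
          rw [show fixedBy (G ⧸ K) h = fixedBy (G ⧸ K) (h : G) from rfl, natCard_mul_natCard_fixedBy_quotient, hL]
    _ = ∑ h ∈ Finset.univ.filter (fun h : G ↦ h ∈ H), ∑ g : G, (if g⁻¹ * h * g ∈ K then 1 else 0) :=
        (Finset.sum_subtype (Finset.univ.filter fun h : G ↦ h ∈ H) (fun h ↦ by simp)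
          (fun h : G ↦ ∑ g : G, (if g⁻¹ * h * g ∈ K then 1 else 0))).symm
    _ = ∑ h : G, ∑ g : G, (if h ∈ H ∧ g⁻¹ * h * g ∈ K then 1 else 0) := by
        rw [Finset.sum_filter]
        refine Finset.sum_congr rfl fun h _ ↦ ?_
        split_ifs with hh
        · simp only [hh, true_and]
        · simp only [hh, false_and, if_false, Finset.sum_const_zero]
    _ = ∑ g : G, ∑ h : G, (if h ∈ H ∧ g⁻¹ * h * g ∈ K then 1 else 0) := Finset.sum_comm
    _ = ∑ g : G, Nat.card ↥(H ⊓ K.map (MulAut.conj g).toMonoidHom) :=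
        Finset.sum_congr rfl fun g _ ↦ (hR g).symm

/-- **`gKg⁻¹ = g'Kg'⁻¹ ⟺ g⁻¹g' ∈ N_G(K)`** (the «packages» of cosets with the same stabilizer are the cosets of the
normalizer). [cite: Rojas2007, Lemma 3.3 (proof), Lemma 3.1] -/
theorem map_conj_eq_map_conj_iff (g g' : G) :
    K.map (MulAut.conj g).toMonoidHom = K.map (MulAut.conj g').toMonoidHom ↔
      g⁻¹ * g' ∈ Subgroup.normalizer (K : Set G) := by
  rw [Subgroup.mem_normalizer_iff, SetLike.ext_iff]
  simp only [mem_map_conj_iff]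
  constructor
  · intro h y
    have hy := h (g' * y * g'⁻¹)
    have e1 : g'⁻¹ * (g' * y * g'⁻¹) * g' = y := by group
    have e2 : g⁻¹ * (g' * y * g'⁻¹) * g = g⁻¹ * g' * y * (g⁻¹ * g')⁻¹ := by group
    rw [e1, e2] at hy
    exact hy.symm
  · intro h w
    have hw := h (g'⁻¹ * w * g')
    have e : g⁻¹ * g' * (g'⁻¹ * w * g') * (g⁻¹ * g')⁻¹ = g⁻¹ * w * g := by group
    rw [e] at hw
    exact hw.symm

open Classical in
/-- **Each fibre of `g ↦ gKg⁻¹` is a coset of `N_G(K)`**: `#{g : gKg⁻¹ = g₀Kg₀⁻¹} = |N_G(K)|` («each package has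
`[N_G(K) : K]` points»). [cite: Rojas2007, Lemma 3.3 (proof), Lemma 3.1] -/
theorem card_filter_map_conj_eq [Fintype G] (g₀ : G) :
    (Finset.univ.filter fun g : G ↦ K.map (MulAut.conj g).toMonoidHom = K.map (MulAut.conj g₀).toMonoidHom).card =
      Nat.card ↥(Subgroup.normalizer (K : Set G)) := by
  rw [Nat.card_eq_fintype_card, ← Fintype.card_coe]
  refine Fintype.card_congr (Equiv.subtypeEquiv (Equiv.mulLeft g₀⁻¹) fun g ↦ ?_)
  rw [Finset.mem_filter, Equiv.coe_mulLeft, eq_comm, map_conj_eq_map_conj_iff]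
  simp only [Finset.mem_univ, true_and]

/-- **Summing a function of the conjugate `gKg⁻¹` over `g ∈ G`: `Σ_{g ∈ G} φ(gKg⁻¹) = |N_G(K)| · Σ_{K' ∼ K} φ(K')`**, the sum
on the right over the distinct conjugates of `K`. [cite: Rojas2007, Lemma 3.3 (proof: «`[G : N_G(K)]` packages, and each
package has `[N_G(K) : K]` points»)] -/
theorem sum_map_conj_eq_card_normalizer_mul_finsum [Fintype G] {A : Type*} [AddCommMonoid A] (φ : Subgroup G → A) :
    ∑ g : G, φ (K.map (MulAut.conj g).toMonoidHom) =
      Nat.card ↥(Subgroup.normalizer (K : Set G)) •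
        ∑ᶠ K' ∈ Set.range (fun g : G ↦ K.map (MulAut.conj g).toMonoidHom), φ K' := by
  classical
  rw [Finset.sum_comp φ (fun g : G ↦ K.map (MulAut.conj g).toMonoidHom)]
  have hrange : Set.range (fun g : G ↦ K.map (MulAut.conj g).toMonoidHom) =
      ↑(Finset.univ.image fun g : G ↦ K.map (MulAut.conj g).toMonoidHom) := by
    rw [Finset.coe_image, Finset.coe_univ, Set.image_univ]
  rw [hrange, finsum_mem_coe_finset, Finset.smul_sum]
  refine Finset.sum_congr rfl fun K' hK' ↦ ?_
  obtain ⟨g₀, -, rfl⟩ := Finset.mem_image.mp hK'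
  rw [card_filter_map_conj_eq]

/-- **`#{gKg⁻¹ : g ∈ G} · |N_G(K)| = |G|`** (orbit–stabilizer for conjugation of subgroups: «`I_K` divided into
`[G : N_G(K)]` packages»). [cite: Rojas2007, Lemma 3.1 (1), Lemma 3.3 (proof)] -/
theorem ncard_range_map_conj_mul_card_normalizer [Fintype G] :
    (Set.range (fun g : G ↦ K.map (MulAut.conj g).toMonoidHom)).ncard * Nat.card ↥(Subgroup.normalizer (K : Set G)) =
      Nat.card G := by
  have h := sum_map_conj_eq_card_normalizer_mul_finsum K (fun _ ↦ (1 : ℕ))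
  rw [Finset.sum_const, Finset.card_univ, smul_eq_mul, mul_one, smul_eq_mul, finsum_one, ← Nat.card_eq_fintype_card] at h
  rw [mul_comm, ← h]

/-- **LEMMA 3.3: `|K| · |H| · |H\G/K| = |N_G(K)| · Σ_{K' ∼ K} |H ∩ K'|`**, the sum over the distinct conjugates
`K' = gKg⁻¹` of `K` (as printed: `|H\G/K| = Σ_{l ∈ Ω_K} [N_G(K) : K]·|K^{l⁻¹} ∩ H|/|H|`, `Ω_K` a transversal of `N_G(K)`).
[cite: Rojas2007, Lemma 3.3] -/
theorem natCard_mul_natCard_mul_natCard_doubleCoset_eq [Finite G] :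
    Nat.card K * (Nat.card H * Nat.card (DoubleCoset.Quotient (H : Set G) K)) =
      Nat.card ↥(Subgroup.normalizer (K : Set G)) *
        ∑ᶠ K' ∈ Set.range (fun g : G ↦ K.map (MulAut.conj g).toMonoidHom), Nat.card ↥(H ⊓ K') := by
  classical
  haveI := Fintype.ofFinite G
  rw [Literature.RepresentationTheory.FiniteGroups.natCard_mul_natCard_doubleCoset_eq_finsum H K,
    finsum_eq_sum_of_fintype, Finset.mul_sum, sum_natCard_fixedBy_quotient_mul_eq_sum_natCard_inf,
    sum_map_conj_eq_card_normalizer_mul_finsum K (fun K' ↦ Nat.card ↥(H ⊓ K')), smul_eq_mul]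

/-- **LEMMA 3.3 combined with `|H|·[G:H] = |G| = #{K' ∼ K}·|N_G(K)|` — the summand of Rojas' (3.1) against that of
(3.3): `[G:H] − |H\G/K| = Σ_{K' ∼ K} (|N_G(K)|/|H|)·(1 − |K' ∩ H|/|K|)`** (over `ℚ`; «Combining this lemma with
Equation 3.1 we obtain […] (3.3)»). [cite: Rojas2007, Lemma 3.3, Prop. 3.2 (3.1), Cor. 3.4 (3.3)] -/
theorem index_sub_natCard_doubleCoset_eq_finsum [Finite G] :
    ((H.index : ℚ) - Nat.card (DoubleCoset.Quotient (H : Set G) K)) =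
      ∑ᶠ K' ∈ Set.range (fun g : G ↦ K.map (MulAut.conj g).toMonoidHom),
        ((Nat.card ↥(Subgroup.normalizer (K : Set G)) : ℚ) / Nat.card H) *
          (1 - (Nat.card ↥(K' ⊓ H) : ℚ) / Nat.card K) := by
  classical
  haveI := Fintype.ofFinite G
  have hCfin : (Set.range (fun g : G ↦ K.map (MulAut.conj g).toMonoidHom)).Finite := Set.toFinite _
  have h33 := natCard_mul_natCard_mul_natCard_doubleCoset_eq H K
  have hCn := ncard_range_map_conj_mul_card_normalizer K
  have hHi := H.card_mul_index
  rw [finsum_mem_eq_finite_toFinset_sum _ hCfin] at h33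
  rw [Set.ncard_eq_toFinset_card _ hCfin] at hCn
  rw [finsum_mem_eq_finite_toFinset_sum _ hCfin]
  set T := hCfin.toFinset with hT
  set n : ℚ := (Nat.card ↥(Subgroup.normalizer (K : Set G)) : ℚ) with hn
  set S : ℚ := ∑ K' ∈ T, (Nat.card ↥(H ⊓ K') : ℚ) with hS
  have hk : (Nat.card K : ℚ) ≠ 0 := Nat.cast_ne_zero.2 Nat.card_pos.ne'
  have hh : (Nat.card H : ℚ) ≠ 0 := Nat.cast_ne_zero.2 Nat.card_pos.ne'
  -- cast the three counting identities to `ℚ`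
  have q33 : (Nat.card K : ℚ) * (Nat.card H * Nat.card (DoubleCoset.Quotient (H : Set G) K)) = n * S := by
    rw [hn, hS]; exact_mod_cast h33
  have qCn : (T.card : ℚ) * n = Nat.card G := by rw [hn]; exact_mod_cast hCn
  have qHi : (Nat.card H : ℚ) * H.index = Nat.card G := by exact_mod_cast hHi
  have eS : ∑ K' ∈ T, n / Nat.card H * (1 - (Nat.card ↥(K' ⊓ H) : ℚ) / Nat.card K) =
      ∑ K' ∈ T, (n / Nat.card H - n / (Nat.card H * Nat.card K) * (Nat.card ↥(H ⊓ K') : ℚ)) :=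
    Finset.sum_congr rfl fun K' _ ↦ by rw [inf_comm]; field_simp
  have e1 : (T.card : ℚ) * (n / Nat.card H) = H.index := by
    rw [← mul_div_assoc, qCn, ← qHi]; field_simp
  have e2 : n / (Nat.card H * Nat.card K) * S = Nat.card (DoubleCoset.Quotient (H : Set G) K) := by
    rw [div_mul_eq_mul_div, div_eq_iff (mul_ne_zero hh hk)]; linarith [q33]
  rw [eS, Finset.sum_sub_distrib, Finset.sum_const, nsmul_eq_mul, ← Finset.mul_sum, ← hS, e1, e2]

/-! ### §2 (v2, ADD-ONLY) Normal subgroups: one conjugate, `|L|·|K|·|K\G/L| = |G|·|K ∩ L|` -/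

/-- A normal subgroup is its only conjugate: `gLg⁻¹ = L`. [folklore] [cite: Rojas2007, Lemma 3.3 (the case
`N_G(K) = G`)] -/
theorem map_conj_eq_self_of_normal [hL : K.Normal] (g : G) : K.map (MulAut.conj g).toMonoidHom = K := by
  ext x
  rw [mem_map_conj_iff]
  constructor
  · intro h
    have h' := hL.conj_mem _ h g
    rwa [show g * (g⁻¹ * x * g) * g⁻¹ = x by group] at h'
  · intro h
    have h' := hL.conj_mem x h g⁻¹
    rwa [inv_inv] at h'

/-- For a normal subgroup the set of conjugates is the singleton `{L}` («`[G : N_G(K)]` packages»: one, when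
`N_G(K) = G`). [cite: Rojas2007, Lemma 3.1 (1), Lemma 3.3 (proof)] -/
theorem range_map_conj_eq_singleton_of_normal [K.Normal] :
    Set.range (fun g : G ↦ K.map (MulAut.conj g).toMonoidHom) = {K} := by
  ext K'
  simp only [Set.mem_range, Set.mem_singleton_iff, map_conj_eq_self_of_normal]
  exact ⟨fun ⟨_, h⟩ ↦ h.symm, fun h ↦ ⟨1, h.symm⟩⟩

/-- **LEMMA 3.3 for a NORMAL subgroup `L`: `|L| · |K| · |K\G/L| = |G| · |K ∩ L|`** (one conjugate, `N_G(L) = G`; e.g.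
in an abelian group `|K\G/L| = |G|·|K ∩ L|/(|K|·|L|) = [G : KL]`). [cite: Rojas2007, Lemma 3.3] -/
theorem natCard_mul_natCard_mul_natCard_doubleCoset_of_normal [Finite G] [K.Normal] :
    Nat.card K * (Nat.card H * Nat.card (DoubleCoset.Quotient (H : Set G) K)) = Nat.card G * Nat.card ↥(H ⊓ K) := by
  rw [natCard_mul_natCard_mul_natCard_doubleCoset_eq, range_map_conj_eq_singleton_of_normal, finsum_mem_singleton,
    Subgroup.normalizer_eq_top, Subgroup.card_top]

/-! ### §3 (v3, ADD-ONLY) LEMMA 5.9: the same count through the conjugacy classes of the elements of `H`,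
`|H\G/K| = (1/|H|) Σ_{a ∈ H} |G|·|K ∩ ā|/(|K|·|ā|)` -/

open Classical in
/-- **The solutions of `g⁻¹ a g = g₀⁻¹ a g₀` form a coset of the centralizer**: there are `|C_G(a)|` of them.
[cite: Rojas2007, Lemma 5.9 (proof: «the cardinality of the orbit of `g_i ∈ I_K` under `a ∈ H` is `|ā|/|ā ∩ K|`»)] -/
theorem card_filter_conj_eq_conj_eq_card_centralizer [Fintype G] (a g₀ : G) :
    (Finset.univ.filter fun g : G ↦ g⁻¹ * a * g = g₀⁻¹ * a * g₀).card = Nat.card ↥(Subgroup.centralizer {a}) := by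
  rw [← Fintype.card_subtype, ← Nat.card_eq_fintype_card]
  refine Nat.card_congr (Equiv.subtypeEquiv (Equiv.mulRight g₀⁻¹) fun g ↦ ?_)
  rw [Equiv.coe_mulRight, Subgroup.mem_centralizer_singleton_iff]
  constructor
  · intro h
    calc g * g₀⁻¹ * a = g * (g₀⁻¹ * a * g₀) * g₀⁻¹ := by group
      _ = g * (g⁻¹ * a * g) * g₀⁻¹ := by rw [h]
      _ = a * (g * g₀⁻¹) := by group
  · intro h
    calc g⁻¹ * a * g = g⁻¹ * (a * (g * g₀⁻¹)) * g₀ := by group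
      _ = g⁻¹ * (g * g₀⁻¹ * a) * g₀ := by rw [h]
      _ = g₀⁻¹ * a * g₀ := by group

open Classical in
/-- **`#{g ∈ G : g⁻¹ a g ∈ K} = |C_G(a)| · |ā ∩ K|`** (`ā` the conjugacy class of `a`: sort the solutions by the value
`b = g⁻¹ag ∈ ā ∩ K`, each attained `|C_G(a)|` times). [cite: Rojas2007, Lemma 5.9 (proof)] -/
theorem natCard_setOf_conj_mem_eq_card_centralizer_mul [Fintype G] (a : G) :
    Nat.card {g : G | g⁻¹ * a * g ∈ K} = Nat.card ↥(Subgroup.centralizer {a}) * (conjugatesOf a ∩ (K : Set G)).ncard := by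
  set S : Finset G := Finset.univ.filter fun g : G ↦ g⁻¹ * a * g ∈ K with hS
  set T : Finset G := Finset.univ.filter fun b : G ↦ IsConj a b ∧ b ∈ K with hT
  have hSc : Nat.card {g : G | g⁻¹ * a * g ∈ K} = S.card := by
    rw [hS, ← Set.ncard_coe_finset, Finset.coe_filter]
    simp only [Finset.mem_univ, true_and, Nat.card_coe_set_eq]
  have hTc : (conjugatesOf a ∩ (K : Set G)).ncard = T.card := by
    rw [hT, ← Set.ncard_coe_finset, Finset.coe_filter]
    congr 1
    ext b
    simp only [Set.mem_inter_iff, conjugatesOf, Set.mem_setOf_eq, SetLike.mem_coe, Finset.mem_univ, true_and]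
  have hmaps : ∀ g ∈ S, (fun g : G ↦ g⁻¹ * a * g) g ∈ T := fun g hg ↦ by
    have hg' : g⁻¹ * a * g ∈ K := (Finset.mem_filter.mp hg).2
    exact Finset.mem_filter.mpr ⟨Finset.mem_univ _, isConj_iff.mpr ⟨g⁻¹, by rw [inv_inv]⟩, hg'⟩
  rw [hSc, hTc, Finset.card_eq_sum_card_fiberwise hmaps]
  rw [Finset.sum_const_nat (m := Nat.card ↥(Subgroup.centralizer {a})) fun b hb ↦ ?_, mul_comm]
  obtain ⟨hab, hbK⟩ := (Finset.mem_filter.mp hb).2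
  obtain ⟨c, hc⟩ := isConj_iff.mp hab
  have hfib : (S.filter fun g ↦ g⁻¹ * a * g = b) = Finset.univ.filter fun g : G ↦ g⁻¹ * a * g = c⁻¹⁻¹ * a * c⁻¹ := by
    ext g
    rw [inv_inv, hc]
    simp only [hS, Finset.mem_filter, Finset.mem_univ, true_and]
    exact ⟨fun h ↦ h.2, fun h ↦ ⟨h ▸ hbK, h⟩⟩
  rw [hfib]
  convert card_filter_conj_eq_conj_eq_card_centralizer a c⁻¹ using 2

/-- **`|C_G(a)| · |ā| = |G|`** (the case `K = G`). [cite: Rojas2007, Lemma 5.9 («`|G|/|ā|`»)] -/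
theorem card_centralizer_mul_ncard_conjugatesOf [Fintype G] (a : G) :
    Nat.card ↥(Subgroup.centralizer {a}) * (conjugatesOf a).ncard = Nat.card G := by
  have h := natCard_setOf_conj_mem_eq_card_centralizer_mul (⊤ : Subgroup G) a
  rw [Subgroup.coe_top, Set.inter_univ] at h
  have huniv : {g : G | g⁻¹ * a * g ∈ (⊤ : Subgroup G)} = Set.univ := Set.eq_univ_of_forall fun _ ↦ Subgroup.mem_top _
  rw [← h, huniv, Nat.card_coe_set_eq, Set.ncard_univ]

/-- **The permutation character of `G` on `G/K` at `a`: `|K| · |Fix_{G/K}(a)| = |C_G(a)| · |ā ∩ K|`** («the number of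
orbits on `I_K` under `a ∈ H` is `[G : K]·|ā ∩ K|/|ā|`» counts the fixed cosets). [cite: Rojas2007, Lemma 5.9 (proof)] -/
theorem natCard_mul_natCard_fixedBy_quotient_eq_card_centralizer_mul [Fintype G] (a : G) :
    Nat.card K * Nat.card (fixedBy (G ⧸ K) a) =
      Nat.card ↥(Subgroup.centralizer {a}) * (conjugatesOf a ∩ (K : Set G)).ncard := by
  rw [natCard_mul_natCard_fixedBy_quotient, natCard_setOf_conj_mem_eq_card_centralizer_mul]

open Classical in
/-- **LEMMA 5.9 (integral form): `|K| · |H| · |H\G/K| = Σ_{a ∈ H} |C_G(a)| · |ā ∩ K|`** (Burnside's count of the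
`H`-orbits on `G/K` with the fixed points of `a` counted through its conjugacy class). [cite: Rojas2007, Lemma 5.9] -/
theorem natCard_mul_natCard_mul_natCard_doubleCoset_eq_sum_centralizer [Fintype G] :
    Nat.card K * (Nat.card H * Nat.card (DoubleCoset.Quotient (H : Set G) K)) =
      ∑ a : ↥H, Nat.card ↥(Subgroup.centralizer {(a : G)}) * (conjugatesOf (a : G) ∩ (K : Set G)).ncard := by
  rw [Literature.RepresentationTheory.FiniteGroups.natCard_mul_natCard_doubleCoset_eq_finsum H K,
    finsum_eq_sum_of_fintype, Finset.mul_sum]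
  refine Finset.sum_congr rfl fun a _ ↦ ?_
  rw [show fixedBy (G ⧸ K) a = fixedBy (G ⧸ K) (a : G) from rfl,
    natCard_mul_natCard_fixedBy_quotient_eq_card_centralizer_mul]

open Classical in
/-- **LEMMA 5.9, as printed: `|H\G/K| = (1/|H|) Σ_{a ∈ H} |G|·|K ∩ ā| / (|K|·|ā|)`** (over `ℚ`; `|G|/|ā| = |C_G(a)|`).
[cite: Rojas2007, Lemma 5.9] -/
theorem natCard_doubleCoset_eq_sum_div [Fintype G] :
    (Nat.card (DoubleCoset.Quotient (H : Set G) K) : ℚ) =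
      1 / Nat.card H * ∑ a : ↥H, (Nat.card G : ℚ) * (((K : Set G) ∩ conjugatesOf (a : G)).ncard : ℚ) /
        ((Nat.card K : ℚ) * (conjugatesOf (a : G)).ncard) := by
  have h := natCard_mul_natCard_mul_natCard_doubleCoset_eq_sum_centralizer H K
  have hH : (Nat.card H : ℚ) ≠ 0 := Nat.cast_ne_zero.2 Nat.card_pos.ne'
  have hK : (Nat.card K : ℚ) ≠ 0 := Nat.cast_ne_zero.2 Nat.card_pos.ne'
  have hterm : ∀ a : ↥H, (Nat.card G : ℚ) * (((K : Set G) ∩ conjugatesOf (a : G)).ncard : ℚ) /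
      ((Nat.card K : ℚ) * (conjugatesOf (a : G)).ncard) =
      ((Nat.card ↥(Subgroup.centralizer {(a : G)}) * (conjugatesOf (a : G) ∩ (K : Set G)).ncard : ℕ) : ℚ) /
        (Nat.card K : ℚ) := by
    intro a
    have hcl : ((conjugatesOf (a : G)).ncard : ℚ) ≠ 0 :=
      Nat.cast_ne_zero.2 ((Set.ncard_pos (Set.toFinite _)).mpr ⟨(a : G), mem_conjugatesOf_self⟩).ne'
    rw [← card_centralizer_mul_ncard_conjugatesOf (a : G), Set.inter_comm]
    push_cast
    field_simp
  have hq : (Nat.card K : ℚ) * (Nat.card H * Nat.card (DoubleCoset.Quotient (H : Set G) K)) =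
      ∑ a : ↥H, ((Nat.card ↥(Subgroup.centralizer {(a : G)}) * (conjugatesOf (a : G) ∩ (K : Set G)).ncard : ℕ) : ℚ) := by
    exact_mod_cast h
  rw [Finset.sum_congr rfl fun a _ ↦ hterm a, ← Finset.sum_div, ← hq]
  field_simp

/-! ### §4 (v4, ADD-ONLY) PROPOSITION 3.5: sorting the double cosets `HgK` by the «mark» `|H ∩ gKg⁻¹|`,
`|K| · |H| · #{HgK : |H ∩ gKg⁻¹| = n} = n · |N_G(K)| · #{K' ∼ K : |H ∩ K'| = n}` -/

/-- `(gk)K(gk)⁻¹ = gKg⁻¹` for `k ∈ K`. [cite: Rojas2007, Lemma 3.1, Lemma 3.3 (proof: «the stabilizer of `g_i ∈ I_K` in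
`G` is `K^{g_i⁻¹}`», well defined on the coset `g_iK`)] -/
theorem map_conj_mul_eq_of_mem (g : G) {k : G} (hk : k ∈ K) :
    K.map (MulAut.conj (g * k)).toMonoidHom = K.map (MulAut.conj g).toMonoidHom := by
  ext x
  rw [mem_map_conj_iff, mem_map_conj_iff, mul_inv_rev,
    show k⁻¹ * g⁻¹ * x * (g * k) = k⁻¹ * (g⁻¹ * x * g) * k by group,
    K.mul_mem_cancel_right hk, K.mul_mem_cancel_left (K.inv_mem hk)]

/-- `(hg)K(hg)⁻¹ = h(gKg⁻¹)h⁻¹`. [cite: Rojas2007, Lemma 3.3 (proof)] -/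
theorem map_conj_mul_eq_map_map (h g : G) :
    K.map (MulAut.conj (h * g)).toMonoidHom = (K.map (MulAut.conj g).toMonoidHom).map (MulAut.conj h).toMonoidHom := by
  rw [Subgroup.map_map]
  congr 1
  ext x
  simp [MulAut.conj_apply, mul_assoc]

/-- For `h ∈ H`: `hHh⁻¹ = H`. [cite: Rojas2007, Lemma 3.1 (1) («`N_G(K)`»)] -/
theorem map_conj_eq_self_of_mem {h : G} (hh : h ∈ H) : H.map (MulAut.conj h).toMonoidHom = H := by
  ext x
  rw [mem_map_conj_iff, H.mul_mem_cancel_right hh, H.mul_mem_cancel_left (H.inv_mem hh)]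

/-- For `h ∈ H` and any subgroup `X`: `H ∩ hXh⁻¹ = h(H ∩ X)h⁻¹`. [cite: Rojas2007, Lemma 3.3 (proof: the stabilizers in `H`
along an `H`-orbit on `I_K` are conjugate in `H`)] -/
theorem inf_map_conj_eq_map_inf_of_mem (X : Subgroup G) {h : G} (hh : h ∈ H) :
    H ⊓ X.map (MulAut.conj h).toMonoidHom = (H ⊓ X).map (MulAut.conj h).toMonoidHom := by
  rw [Subgroup.map_inf_eq H X _ (MulAut.conj h).injective, map_conj_eq_self_of_mem H hh]

/-- **The mark `|H ∩ gKg⁻¹|` is constant along the double coset `HgK`** (for `g' = hgk`: `H ∩ g'Kg'⁻¹ = h(H ∩ gKg⁻¹)h⁻¹`;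
«the stabilizer in `H` of an element `g_i ∈ I_K` is `K^{g_i⁻¹} ∩ H`», and the points of one `H`-orbit have conjugate
stabilizers). [cite: Rojas2007, Lemma 3.3 (proof), Proposition 3.5] -/
theorem natCard_inf_map_conj_eq_of_mk_eq {g₁ g₂ : G}
    (hD : (DoubleCoset.mk H K g₁ : DoubleCoset.Quotient (H : Set G) K) = DoubleCoset.mk H K g₂) :
    Nat.card ↥(H ⊓ K.map (MulAut.conj g₁).toMonoidHom) = Nat.card ↥(H ⊓ K.map (MulAut.conj g₂).toMonoidHom) := by
  obtain ⟨a, ha, k, hk, rfl⟩ := (DoubleCoset.eq H K g₁ g₂).1 hD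
  rw [map_conj_mul_eq_of_mem K (a * g₁) hk, map_conj_mul_eq_map_map K a g₁, inf_map_conj_eq_map_inf_of_mem H _ ha,
    Subgroup.card_map_of_injective (MulAut.conj a).injective]

/-- The mark of a double coset `D = HgK` computed at the chosen representative `D.out`: `|H ∩ D.out K D.out⁻¹| = |H ∩ gKg⁻¹|`.
[cite: Rojas2007, Lemma 3.3 (proof), Proposition 3.5] -/
theorem natCard_inf_map_conj_out_mk (g : G) :
    Nat.card ↥(H ⊓ K.map (MulAut.conj (DoubleCoset.mk H K g : DoubleCoset.Quotient (H : Set G) K).out).toMonoidHom) =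
      Nat.card ↥(H ⊓ K.map (MulAut.conj g).toMonoidHom) :=
  natCard_inf_map_conj_eq_of_mk_eq H K (DoubleCoset.out_eq' H K _)

open Classical in
/-- **Counting the `g ∈ G` of mark `n` through their double cosets: `n · #{g ∈ G : |H ∩ gKg⁻¹| = n} =
|H| · |K| · #{HgK : |H ∩ gKg⁻¹| = n}`** (each double coset `HgK` of mark `n` has `|H|·|K|/n` elements, «the cardinality
of the orbit `|O_H(g_iK)|` is `|H|/|K^{g_i⁻¹} ∩ H|`»). [cite: Rojas2007, Lemma 3.3 (proof), Proposition 3.5] -/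
theorem mul_natCard_setOf_natCard_inf_map_conj_eq [Finite G] (n : ℕ) :
    n * Nat.card {g : G | Nat.card ↥(H ⊓ K.map (MulAut.conj g).toMonoidHom) = n} =
      Nat.card H * Nat.card K *
        Nat.card {D : DoubleCoset.Quotient (H : Set G) K | Nat.card ↥(H ⊓ K.map (MulAut.conj D.out).toMonoidHom) = n} := by
  haveI := Fintype.ofFinite G
  haveI : Finite (DoubleCoset.Quotient (H : Set G) K) := Quotient.finite _
  haveI : Fintype (DoubleCoset.Quotient (H : Set G) K) := Fintype.ofFinite _
  set S : Finset G := Finset.univ.filter fun g : G ↦ Nat.card ↥(H ⊓ K.map (MulAut.conj g).toMonoidHom) = n with hS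
  set T : Finset (DoubleCoset.Quotient (H : Set G) K) :=
    Finset.univ.filter fun D ↦ Nat.card ↥(H ⊓ K.map (MulAut.conj D.out).toMonoidHom) = n with hT
  have hSc : Nat.card {g : G | Nat.card ↥(H ⊓ K.map (MulAut.conj g).toMonoidHom) = n} = S.card := by
    rw [hS, ← Set.ncard_coe_finset, Finset.coe_filter]
    simp only [Finset.mem_univ, true_and, Nat.card_coe_set_eq]
  have hTc : Nat.card {D : DoubleCoset.Quotient (H : Set G) K |
      Nat.card ↥(H ⊓ K.map (MulAut.conj D.out).toMonoidHom) = n} = T.card := by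
    rw [hT, ← Set.ncard_coe_finset, Finset.coe_filter]
    simp only [Finset.mem_univ, true_and, Nat.card_coe_set_eq]
  have hmaps : ∀ g ∈ S, DoubleCoset.mk H K g ∈ T := fun g hg ↦ by
    rw [hT, Finset.mem_filter, natCard_inf_map_conj_out_mk]
    exact ⟨Finset.mem_univ _, (Finset.mem_filter.mp hg).2⟩
  rw [hSc, hTc, Finset.card_eq_sum_card_fiberwise hmaps, Finset.mul_sum,
    Finset.sum_const_nat (m := Nat.card H * Nat.card K) fun D hD ↦ ?_, mul_comm]
  have hD' : Nat.card ↥(H ⊓ K.map (MulAut.conj D.out).toMonoidHom) = n := (Finset.mem_filter.mp hD).2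
  -- the fibre of `g ↦ HgK` over `D` inside `S` is the whole double coset `H·D.out·K`
  have hfib : (S.filter fun g ↦ DoubleCoset.mk H K g = D) = Finset.univ.filter fun g : G ↦ DoubleCoset.mk H K g = D := by
    ext g
    simp only [hS, Finset.mem_filter, Finset.mem_univ, true_and, and_iff_right_iff_imp]
    intro hg
    rw [← natCard_inf_map_conj_out_mk H K g, hg, hD']
  have hdc : (Finset.univ.filter fun g : G ↦ DoubleCoset.mk H K g = D).card =
      Nat.card (DoubleCoset.doubleCoset D.out (H : Set G) K) := by
    have hset : DoubleCoset.doubleCoset D.out (H : Set G) K = {g : G | DoubleCoset.mk H K g = D} :=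
      Set.ext fun g ↦ DoubleCoset.mem_quotToDoubleCoset_iff D g
    rw [hset, ← Set.ncard_coe_finset, Finset.coe_filter]
    simp only [Finset.mem_univ, true_and, Nat.card_coe_set_eq]
  have hsize := natCard_doubleCoset_mul_natCard_inf_conj H K D.out
  rw [hD'] at hsize
  rw [hfib, hdc, mul_comm, hsize]

open Classical in
/-- **Counting the `g ∈ G` of mark `n` through the conjugates `gKg⁻¹` («packages»): `#{g ∈ G : |H ∩ gKg⁻¹| = n} =
|N_G(K)| · #{K' ∼ K : |H ∩ K'| = n}`** (each conjugate `K'` is `gKg⁻¹` for `|N_G(K)|` elements `g`; Rojas' `L_{jk}` is the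
set of `l` in a transversal `Ω_K` of `N_G(K)` with `|K^{l⁻¹} ∩ H| = n`). [cite: Rojas2007, Proposition 3.5, Lemma 3.3 (proof)] -/
theorem natCard_setOf_natCard_inf_map_conj_eq [Finite G] (n : ℕ) :
    Nat.card {g : G | Nat.card ↥(H ⊓ K.map (MulAut.conj g).toMonoidHom) = n} =
      Nat.card ↥(Subgroup.normalizer (K : Set G)) *
        {K' ∈ Set.range (fun g : G ↦ K.map (MulAut.conj g).toMonoidHom) | Nat.card ↥(H ⊓ K') = n}.ncard := by
  haveI := Fintype.ofFinite G
  have hCfin : (Set.range (fun g : G ↦ K.map (MulAut.conj g).toMonoidHom)).Finite := Set.toFinite _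
  have h := sum_map_conj_eq_card_normalizer_mul_finsum K (fun K' ↦ if Nat.card ↥(H ⊓ K') = n then 1 else 0)
  rw [finsum_mem_eq_finite_toFinset_sum _ hCfin, Finset.sum_ite, Finset.sum_const_zero, add_zero, Finset.sum_const,
    smul_eq_mul, mul_one, smul_eq_mul, Finset.sum_ite, Finset.sum_const_zero, add_zero, Finset.sum_const, smul_eq_mul,
    mul_one] at h
  have hL : Nat.card {g : G | Nat.card ↥(H ⊓ K.map (MulAut.conj g).toMonoidHom) = n} =
      (Finset.univ.filter fun g : G ↦ Nat.card ↥(H ⊓ K.map (MulAut.conj g).toMonoidHom) = n).card := by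
    rw [← Set.ncard_coe_finset, Finset.coe_filter]
    simp only [Finset.mem_univ, true_and, Nat.card_coe_set_eq]
  have hR : {K' ∈ Set.range (fun g : G ↦ K.map (MulAut.conj g).toMonoidHom) | Nat.card ↥(H ⊓ K') = n}.ncard =
      (hCfin.toFinset.filter fun K' ↦ Nat.card ↥(H ⊓ K') = n).card := by
    rw [← Set.ncard_coe_finset, Finset.coe_filter]
    congr 1
    ext K'
    simp only [Set.Finite.mem_toFinset, Set.mem_setOf_eq]
  rw [hL, hR, h]

/-- **PROPOSITION 3.5 (group-theoretic form): `|K| · |H| · #{HgK ∈ H\G/K : |H ∩ gKg⁻¹| = n} =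
n · |N_G(K)| · #{K' ∼ K : |H ∩ K'| = n}`.**  For the left cosets `I_K = G/K` acted on by `H` (Rojas: the points of `S`
over a branch value of type `K = G_j`, and their images in `S/H`), the `H`-orbits — double cosets `HgK` — whose points have
stabilizer `H ∩ gKg⁻¹` of order `n` («marked with the number `n`») number `c = |L|·[N_G(K) : K]·n/|H|`, where `|L| = #{K' ∼ K :
|K' ∩ H| = n}` (Rojas' `L_{jk}` inside a transversal of `N_G(K)`). [cite: Rojas2007, Proposition 3.5] -/
theorem natCard_mul_natCard_mul_natCard_doubleCoset_mark_eq [Finite G] (n : ℕ) :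
    Nat.card K * (Nat.card H *
      Nat.card {D : DoubleCoset.Quotient (H : Set G) K | Nat.card ↥(H ⊓ K.map (MulAut.conj D.out).toMonoidHom) = n}) =
      n * (Nat.card ↥(Subgroup.normalizer (K : Set G)) *
        {K' ∈ Set.range (fun g : G ↦ K.map (MulAut.conj g).toMonoidHom) | Nat.card ↥(H ⊓ K') = n}.ncard) := by
  rw [← natCard_setOf_natCard_inf_map_conj_eq, mul_natCard_setOf_natCard_inf_map_conj_eq]
  ring

/-- **PROPOSITION 3.5, as printed: `c = |L| · [N_G(K) : K] · n / |H|`** — the number of double cosets `HgK` of mark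
`|H ∩ gKg⁻¹| = n` («points on `S/H` marked with the number `|G_j^{l⁻¹} ∩ H|`» over one branch value of type `G_j = K`), with
`|L| = #{K' ∼ K : |K' ∩ H| = n}` and `[N_G(K) : K] = |N_G(K)|/|K|` (over `ℚ`). [cite: Rojas2007, Proposition 3.5] -/
theorem natCard_doubleCoset_mark_eq_div [Finite G] (n : ℕ) :
    (Nat.card {D : DoubleCoset.Quotient (H : Set G) K |
        Nat.card ↥(H ⊓ K.map (MulAut.conj D.out).toMonoidHom) = n} : ℚ) =
      {K' ∈ Set.range (fun g : G ↦ K.map (MulAut.conj g).toMonoidHom) | Nat.card ↥(H ⊓ K') = n}.ncard *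
        ((Nat.card ↥(Subgroup.normalizer (K : Set G)) : ℚ) / Nat.card K * n) / Nat.card H := by
  have h := natCard_mul_natCard_mul_natCard_doubleCoset_mark_eq H K n
  have hH : (Nat.card H : ℚ) ≠ 0 := Nat.cast_ne_zero.2 Nat.card_pos.ne'
  have hK : (Nat.card K : ℚ) ≠ 0 := Nat.cast_ne_zero.2 Nat.card_pos.ne'
  have hq : (Nat.card K : ℚ) * (Nat.card H * Nat.card {D : DoubleCoset.Quotient (H : Set G) K |
      Nat.card ↥(H ⊓ K.map (MulAut.conj D.out).toMonoidHom) = n}) =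
      n * (Nat.card ↥(Subgroup.normalizer (K : Set G)) *
        {K' ∈ Set.range (fun g : G ↦ K.map (MulAut.conj g).toMonoidHom) | Nat.card ↥(H ⊓ K') = n}.ncard) := by
    exact_mod_cast h
  field_simp
  linarith [hq]

end Lemma33

/-! ### §5 (v5, ADD-ONLY) The same count in the currency of the permutation character `1_K^G = indClassFun K 1`
(`PermutationCharacter`, `TransitivePermutationCharacter`): `|K| · 1_K^G(a) = |C_G(a)| · |ā ∩ K|` -/

section ConjugacyClassCurrency

variable {G : Type*} [Group G] (K : Subgroup G)

/-- `|ā| = #{x : x ∼ a}`: the conjugacy class as a set (`conjugatesOf a`, this file and Rojas' `ā`) against the subtype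
`{x // IsConj a x}` of `TransitivePermutationCharacter` (Isaacs' `Cl(g)`). [cite: Rojas2007, Lemma 5.9]
[cite: Isaacs1976, Thm. 5.18 (g)] -/
theorem ncard_conjugatesOf_eq_natCard_subtype_isConj (a : G) :
    (conjugatesOf a).ncard = Nat.card {x : G // IsConj a x} := by
  rw [← Nat.card_coe_set_eq]
  rfl

/-- `|ā ∩ K| = #{k ∈ K : k ∼ a}` (Rojas' `|K ∩ ā|` against Isaacs' `|Cl(g) ∩ H|` as the subtype of `↥K` used in
`TransitivePermutationCharacter.natCard_isConj_mul_natCard_fixedBy`). [cite: Rojas2007, Lemma 5.9] [cite: Isaacs1976, Thm. 5.18 (g)] -/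
theorem ncard_conjugatesOf_inter_eq_natCard_subtype_isConj (a : G) :
    (conjugatesOf a ∩ (K : Set G)).ncard = Nat.card {k : K // IsConj a (k : G)} := by
  rw [← Nat.card_coe_set_eq]
  exact Nat.card_congr
    { toFun := fun x ↦ ⟨⟨x.1, x.2.2⟩, x.2.1⟩
      invFun := fun k ↦ ⟨k.1, k.2, k.1.2⟩
      left_inv := fun _ ↦ rfl
      right_inv := fun _ ↦ rfl }

end ConjugacyClassCurrency

section PermutationCharacter

variable {G : Type} [Group G] [Fintype G] (K : Subgroup G)

open Literature.RepresentationTheory.FiniteGroups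

/-- **The permutation character `1_K^G` at `a`: `|K| · 1_K^G(a) = |C_G(a)| · |ā ∩ K|`** («the number of orbits on `I_K` under
`a ∈ H` is `[G : K]·|ā ∩ K|/|ā|`»: the fixed cosets; `1_K^G = (g ↦ |Fix_{G/K}(g)|)` is `indClassFun_one_eq_natCard_fixedBy_quotient`).
[cite: Rojas2007, Lemma 5.9 (proof)] [cite: Isaacs1976, Lemma 5.14, Thm. 5.18 (g) (proof)] -/
theorem natCard_mul_indClassFun_one_apply (a : G) :
    (Nat.card K : ℂ) * indClassFun K (1 : K → ℂ) a =
      (Nat.card ↥(Subgroup.centralizer {a}) : ℂ) * ((conjugatesOf a ∩ (K : Set G)).ncard : ℂ) := by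
  rw [indClassFun_one_eq_natCard_fixedBy_quotient K]
  beta_reduce
  exact_mod_cast natCard_mul_natCard_fixedBy_quotient_eq_card_centralizer_mul K a

/-- **`1_K^G(a) = |C_G(a)| · |ā ∩ K| / |K|`.** [cite: Rojas2007, Lemma 5.9 (proof)] [cite: Isaacs1976, Thm. 5.18 (g) (proof:
«`|𝒦|χ(g) = m|Ω| = mχ(1)`», `m = |𝒦 ∩ H|`)] -/
theorem indClassFun_one_apply_eq_card_centralizer_mul_div (a : G) :
    indClassFun K (1 : K → ℂ) a =
      (Nat.card ↥(Subgroup.centralizer {a}) : ℂ) * ((conjugatesOf a ∩ (K : Set G)).ncard : ℂ) / Nat.card K := by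
  have hK : (Nat.card K : ℂ) ≠ 0 := Nat.cast_ne_zero.2 Nat.card_pos.ne'
  rw [eq_div_iff hK, mul_comm, natCard_mul_indClassFun_one_apply]

/-- **`1_K^G(a) = [G : K] · |ā ∩ K| / |ā|`** — the number of cosets of `K` fixed by `a`, AS PRINTED by Rojas («the number
of orbits on `I_K` under `a ∈ H` is `[G : K]·|ā ∩ K|/|ā|`») and by Isaacs (`χ(g) = m·χ(1)/|𝒦|`, `χ(1) = |G : K|`).
[cite: Rojas2007, Lemma 5.9 (proof)] [cite: Isaacs1976, Thm. 5.18 (g) (proof)] -/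
theorem indClassFun_one_apply_eq_index_mul_div (a : G) :
    indClassFun K (1 : K → ℂ) a = (K.index : ℂ) * ((conjugatesOf a ∩ (K : Set G)).ncard : ℂ) / (conjugatesOf a).ncard := by
  have hK : (Nat.card K : ℂ) ≠ 0 := Nat.cast_ne_zero.2 Nat.card_pos.ne'
  have hcl : ((conjugatesOf a).ncard : ℂ) ≠ 0 :=
    Nat.cast_ne_zero.2 ((Set.ncard_pos (Set.toFinite _)).mpr ⟨a, mem_conjugatesOf_self⟩).ne'
  have h1 := natCard_mul_indClassFun_one_apply K a
  have h2 : (Nat.card ↥(Subgroup.centralizer {a}) : ℂ) * (conjugatesOf a).ncard = Nat.card G := by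
    exact_mod_cast card_centralizer_mul_ncard_conjugatesOf a
  have h3 : (Nat.card K : ℂ) * K.index = Nat.card G := by exact_mod_cast K.card_mul_index
  rw [eq_div_iff hcl]
  apply mul_left_cancel₀ hK
  calc (Nat.card K : ℂ) * (indClassFun K (1 : K → ℂ) a * (conjugatesOf a).ncard)
      = (Nat.card ↥(Subgroup.centralizer {a}) : ℂ) * (conjugatesOf a).ncard * ((conjugatesOf a ∩ (K : Set G)).ncard : ℂ) := by
        rw [← mul_assoc, h1]; ring
    _ = (Nat.card K : ℂ) * ((K.index : ℂ) * ((conjugatesOf a ∩ (K : Set G)).ncard : ℂ)) := by rw [h2, ← h3]; ring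

end PermutationCharacter

end Literature.GroupTheory.Index
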